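import Summits.AtomisticToContinuum.HydrodynamicLimit.Theorems.CollisionIsometryCLTMacroClosureBarycentricDefs
import Summits.AtomisticToContinuum.HydrodynamicLimit.Theorems.CollisionIsometryCLTMacroClosureStubLedgerTransport
import Summits.AtomisticToContinuum.HydrodynamicLimit.Theorems.JaynesSqueezeSqueezeToBlockGibbsTimeZero
import HarnessLib

/-!
# Stub `stub_clausius` of the line `IdeatorTwoGen1Sketch` (crux `MacroClosure`, stmt-14870), part 4:
# statics of the local Gibbs law — finite relative entropy, second moment of the kinetic energy,
# almost surely distinct velocities

Support file (`--supports stmt-AtomisticToContinuum-14870`) for the registered stub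
`Barycentric.stub_clausius`; it lands the registered sub-goal `stub_clausius_moment`.

* `Clausius.klDiv_localGibbsLaw_ne_top` — two local Gibbs laws with continuous positive parameters
  (`σ ≤ 1/2`) have finite relative entropy: both are positive densities w.r.t. the Liouville measure,
  the log-likelihood ratio is `(N+1)(⟨emp, log prof₁⟩ − ⟨emp, log prof₂⟩) + const`, dominated by the
  kinetic energy, which is integrable (`integrable_kineticPair_localGibbsLaw`).
* `Clausius.sq_energy_moment` — `E_P[e²] ≤ M` uniformly in `N` for the per-particle kinetic energy
  `e = ⟨emp, |v|²/2⟩`: conditionally on the positions the velocities are independent Gaussians, and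
  `e² ≤ 2Θ² (N+1)⁻¹Σ‖vᵢ−u₀(xᵢ)‖⁴/θ₀(xᵢ)² + 2U⁴`, whose mean is `2Θ² E‖w‖⁴ + 2U⁴`.
* `Clausius.ae_pairwise_vel_ne` — under the push-forward of a local Gibbs law by any flow map,
  almost surely all velocities are pairwise distinct (coincidence hyperplanes are Lebesgue-null and
  the law is absolutely continuous w.r.t. the invariant Liouville measure).
-/

noncomputable section

open MeasureTheory Filter Set Topology InformationTheory ProbabilityTheory
open scoped ENNReal ContDiff

namespace Summit.AtomisticToContinuum.HydrodynamicLimit.Theorems.MacroClosureLine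

open Literature.MathematicalPhysics.KineticTheory Literature.Analysis.FluidPDE
open Literature.Analysis.FunctionSpaces
open StubLedger JaynesSqueezeSqueeze

namespace Barycentric

namespace Clausius

variable {N : ℕ}

/-! ## Finite relative entropy between two local Gibbs laws -/

/-- **Two local Gibbs laws have finite relative entropy** (continuous positive parameters,
`σ ≤ 1/2`). [folklore] -/
theorem klDiv_localGibbsLaw_ne_top {σ : ℝ} (hσ2 : σ ≤ 1 / 2) (Φ : Flow σ N)
    {a₁ θ₁ a₂ θ₂ : T3 → ℝ} {u₁ u₂ : T3 → V3} (ha₁ : Continuous a₁) (hθ₁ : Continuous θ₁)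
    (hu₁ : Continuous u₁) (ha₂ : Continuous a₂) (hθ₂ : Continuous θ₂) (hu₂ : Continuous u₂)
    (ha₁0 : ∀ x, 0 < a₁ x) (hθ₁0 : ∀ x, 0 < θ₁ x) (ha₂0 : ∀ x, 0 < a₂ x) (hθ₂0 : ∀ x, 0 < θ₂ x) :
    klDiv (localGibbsLaw σ a₁ u₁ θ₁ N Φ) (localGibbsLaw σ a₂ u₂ θ₂ N Φ) ≠ ⊤ := by
  have hK := integrable_kineticPair_localGibbsLaw hσ2 ha₁ hθ₁ hu₁ ha₁0 hθ₁0 N Φ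
  haveI hP₁ := isProbabilityMeasure_localGibbsLaw ha₁ hθ₁ hu₁ ha₁0 hθ₁0 hσ2 N Φ
  haveI hP₂ := isProbabilityMeasure_localGibbsLaw ha₂ hθ₂ hu₂ ha₂0 hθ₂0 hσ2 N Φ
  rw [localGibbsLaw_eq_particleLaw_tensorPow Φ] at hK hP₁ hP₂ ⊢
  rw [localGibbsLaw_eq_particleLaw_tensorPow Φ]
  set W₁ : Config (N + 1) (Fin 3) T3 → ℝ := fun z =>
    (canonicalPartition (Torus.geometry (Fin 3)) (hsDiameter σ N) (N + 1) (localGibbsProfile a₁ u₁ θ₁))⁻¹ *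
      tensorPow (N + 1) (localGibbsProfile a₁ u₁ θ₁) z with hW₁
  set W₂ : Config (N + 1) (Fin 3) T3 → ℝ := fun z =>
    (canonicalPartition (Torus.geometry (Fin 3)) (hsDiameter σ N) (N + 1) (localGibbsProfile a₂ u₂ θ₂))⁻¹ *
      tensorPow (N + 1) (localGibbsProfile a₂ u₂ θ₂) z with hW₂
  have hW₁m : Measurable W₁ := measurable_gibbsDensity σ N ha₁ hθ₁ hu₁
  have hW₂m : Measurable W₂ := measurable_gibbsDensity σ N ha₂ hθ₂ hu₂
  have hW₁pos : ∀ z, 0 < W₁ z := gibbsDensity_pos hσ2 N ha₁ hθ₁ hu₁ ha₁0 hθ₁0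
  have hW₂pos : ∀ z, 0 < W₂ z := gibbsDensity_pos hσ2 N ha₂ hθ₂ hu₂ ha₂0 hθ₂0
  -- absolute continuity through the Liouville measure
  have hg : Measurable fun z => ENNReal.ofReal (W₂ z) := ENNReal.measurable_ofReal.comp hW₂m
  have hg0 : ∀ᵐ z ∂(liouville (Torus.geometry (Fin 3)) (N + 1) (hsDiameter σ N)),
      ENNReal.ofReal (W₂ z) ≠ 0 := ae_of_all _ fun z => (ENNReal.ofReal_pos.mpr (hW₂pos z)).ne'
  have hμL : particleLaw Φ W₁ ≪ liouville (Torus.geometry (Fin 3)) (N + 1) (hsDiameter σ N) :=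
    withDensity_absolutelyContinuous _ _
  have hLν : liouville (Torus.geometry (Fin 3)) (N + 1) (hsDiameter σ N) ≪ particleLaw Φ W₂ :=
    withDensity_absolutelyContinuous' hg.aemeasurable hg0
  refine klDiv_ne_top_iff.2 ⟨hμL.trans hLν, ?_⟩
  -- integrability of the log-likelihood ratio from the kinetic energy
  have hllr := llr_particleLaw_ae Φ hW₁m hW₂m (fun z => (hW₁pos z).le) hW₂pos
  refine Integrable.congr ?_ hllr.symm
  have hI₁ := integrable_logPair_comp (a := a₁) (θ := θ₁) (u := u₁) ha₁ hθ₁ hu₁ ha₁0 hθ₁0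
    measurable_id hK
  have hI₂ := integrable_logPair_comp (a := a₂) (θ := θ₂) (u := u₂) ha₂ hθ₂ hu₂ ha₂0 hθ₂0
    measurable_id hK
  simp only [id] at hI₁ hI₂
  have hlog : ∀ z, Real.log (W₁ z) - Real.log (W₂ z) =
      (((N : ℝ) + 1) * (∫ y, Real.log (localGibbsProfile a₁ u₁ θ₁ y) ∂(empiricalMeasure z)) -
        ((N : ℝ) + 1) * (∫ y, Real.log (localGibbsProfile a₂ u₂ θ₂ y) ∂(empiricalMeasure z))) +
      (Real.log (canonicalPartition (Torus.geometry (Fin 3)) (hsDiameter σ N) (N + 1)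
          (localGibbsProfile a₂ u₂ θ₂)) -
        Real.log (canonicalPartition (Torus.geometry (Fin 3)) (hsDiameter σ N) (N + 1)
          (localGibbsProfile a₁ u₁ θ₁))) := by
    intro z
    rw [hW₁, hW₂]
    simp only
    rw [log_gibbsDensity hσ2 N ha₁ hθ₁ hu₁ ha₁0 hθ₁0, log_gibbsDensity hσ2 N ha₂ hθ₂ hu₂ ha₂0 hθ₂0]
    ring
  simp_rw [hlog]
  exact ((hI₁.const_mul _).sub (hI₂.const_mul _)).add (integrable_const _)

/-! ## The second moment of the per-particle kinetic energy -/

/-- `∫ ‖v − u‖⁴/θ² dN(u,θ) = ∫ ‖w‖⁴ d(std Gaussian)` and integrability (`θ > 0`). [folklore] -/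
theorem integral_norm_sub_pow_four_gaussMeasure (u : V3) {θ : ℝ} (hθ : 0 < θ) :
    Integrable (fun v : V3 => ‖v - u‖ ^ 4 / θ ^ 2) (gaussMeasure u θ) ∧
      ∫ v, ‖v - u‖ ^ 4 / θ ^ 2 ∂gaussMeasure u θ = ∫ w, ‖w‖ ^ 4 ∂stdGaussian V3 := by
  have hpt : ∀ w : V3, ‖u + Real.sqrt θ • w - u‖ ^ 4 / θ ^ 2 = ‖w‖ ^ 4 := by
    intro w
    rw [add_sub_cancel_left, norm_smul, Real.norm_eq_abs, abs_of_nonneg (Real.sqrt_nonneg θ), mul_pow,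
      show (4 : ℕ) = 2 * 2 from rfl, pow_mul, Real.sq_sqrt hθ.le]
    field_simp
  constructor
  · rw [gaussMeasure, ← coe_gaussShiftEquiv u hθ]
    refine (integrable_map_equiv (gaussShiftEquiv u hθ) _).2 ?_
    have : ((fun v : V3 => ‖v - u‖ ^ 4 / θ ^ 2) ∘ (gaussShiftEquiv u hθ)) = fun w => ‖w‖ ^ 4 := by
      funext w
      simp only [Function.comp_apply, coe_gaussShiftEquiv, hpt]
    rw [this]
    exact integrable_norm_pow_four_stdGaussian
  · rw [integral_gaussMeasure u hθ]
    simp_rw [hpt]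

/-- The normalised quartic velocity fluctuation `(N+1)⁻¹ Σᵢ ‖vᵢ − u₀(xᵢ)‖⁴/θ₀(xᵢ)²` is measurable.
[folklore] -/
theorem measurable_velFluct4 {u₀ : T3 → V3} {θ₀ : T3 → ℝ} (hu : Continuous u₀) (hθ : Continuous θ₀)
    (N : ℕ) : Measurable fun z : Config (N + 1) (Fin 3) T3 =>
      ((N : ℝ) + 1)⁻¹ * ∑ i, ‖(z i).2 - u₀ (z i).1‖ ^ 4 / θ₀ (z i).1 ^ 2 := by
  refine measurable_const.mul (Finset.measurable_sum _ fun i _ => ?_)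
  exact (((measurable_pi_apply i).snd.sub (hu.measurable.comp (measurable_pi_apply i).fst)).norm.pow_const
    4).div ((hθ.measurable.comp (measurable_pi_apply i).fst).pow_const 2)

/-- **Mean of the quartic velocity fluctuation** under the local Gibbs law: it is integrable with mean
`E‖w‖⁴` (standard Gaussian on `ℝ³`). [folklore] -/
theorem integral_velFluct4_localGibbsLaw {σ : ℝ} (hσ2 : σ ≤ 1 / 2) {a₀ θ₀ : T3 → ℝ} {u₀ : T3 → V3}
    (ha : Continuous a₀) (hθ : Continuous θ₀) (hu : Continuous u₀) (ha0 : ∀ x, 0 < a₀ x)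
    (hθ0 : ∀ x, 0 < θ₀ x) (N : ℕ) (Φ : Flow σ N) :
    Integrable (fun z : Config (N + 1) (Fin 3) T3 =>
        ((N : ℝ) + 1)⁻¹ * ∑ i, ‖(z i).2 - u₀ (z i).1‖ ^ 4 / θ₀ (z i).1 ^ 2) (localGibbsLaw σ a₀ u₀ θ₀ N Φ) ∧
      ∫ z, ((N : ℝ) + 1)⁻¹ * ∑ i, ‖(z i).2 - u₀ (z i).1‖ ^ 4 / θ₀ (z i).1 ^ 2
          ∂(localGibbsLaw σ a₀ u₀ θ₀ N Φ) = ∫ w, ‖w‖ ^ 4 ∂stdGaussian V3 := by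
  haveI := isProbabilityMeasure_localGibbsMeasure ha hθ hu ha0 hθ0 hσ2 N
  set m4 : ℝ := ∫ w, ‖w‖ ^ 4 ∂stdGaussian V3 with hm4
  have hm4_0 : 0 ≤ m4 := integral_nonneg fun w => by positivity
  set F : Config (N + 1) (Fin 3) T3 → ℝ := fun z =>
    ((N : ℝ) + 1)⁻¹ * ∑ i, ‖(z i).2 - u₀ (z i).1‖ ^ 4 / θ₀ (z i).1 ^ 2 with hF
  have hFm : Measurable F := measurable_velFluct4 hu hθ N
  have hF0 : ∀ z, 0 ≤ F z := fun z => mul_nonneg (inv_nonneg.2 (by positivity))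
    (Finset.sum_nonneg fun i _ => by positivity)
  -- the conditional (velocity) integral, uniformly in the positions
  have hvel : ∀ x : Fin (N + 1) → T3,
      ∫⁻ v, ENNReal.ofReal (F (zipConfig (x, v))) ∂velMeasure u₀ θ₀ x = ENNReal.ofReal m4 := by
    intro x
    have hint : ∀ i : Fin (N + 1), Integrable
        (fun v : Fin (N + 1) → V3 => ‖v i - u₀ (x i)‖ ^ 4 / θ₀ (x i) ^ 2) (velMeasure u₀ θ₀ x) := fun i =>
      integrable_comp_eval (μ := fun j => gaussMeasure (u₀ (x j)) (θ₀ (x j)))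
        (f := fun w : V3 => ‖w - u₀ (x i)‖ ^ 4 / θ₀ (x i) ^ 2)
        (integral_norm_sub_pow_four_gaussMeasure _ (hθ0 _)).1
    have hsum : Integrable (fun v : Fin (N + 1) → V3 => ∑ i, ‖v i - u₀ (x i)‖ ^ 4 / θ₀ (x i) ^ 2)
        (velMeasure u₀ θ₀ x) := integrable_finsetSum _ fun i _ => hint i
    have hval : ∫ v, (∑ i, ‖v i - u₀ (x i)‖ ^ 4 / θ₀ (x i) ^ 2) ∂velMeasure u₀ θ₀ x =
        ((N : ℝ) + 1) * m4 := by
      rw [integral_finsetSum _ fun i _ => hint i]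
      have hterm : ∀ i : Fin (N + 1),
          ∫ v, ‖v i - u₀ (x i)‖ ^ 4 / θ₀ (x i) ^ 2 ∂velMeasure u₀ θ₀ x = m4 := by
        intro i
        rw [velMeasure, integral_comp_eval (μ := fun j => gaussMeasure (u₀ (x j)) (θ₀ (x j)))
          (f := fun w : V3 => ‖w - u₀ (x i)‖ ^ 4 / θ₀ (x i) ^ 2) (by fun_prop)]
        exact (integral_norm_sub_pow_four_gaussMeasure _ (hθ0 _)).2
      simp only [hterm, Finset.sum_const, Finset.card_univ, Fintype.card_fin, nsmul_eq_mul]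
      push_cast
      ring
    have hFx : ∀ v : Fin (N + 1) → V3, F (zipConfig (x, v)) =
        ((N : ℝ) + 1)⁻¹ * ∑ i, ‖v i - u₀ (x i)‖ ^ 4 / θ₀ (x i) ^ 2 := by
      intro v; simp [hF, zipConfig_apply]
    simp_rw [hFx]
    rw [← ofReal_integral_eq_lintegral_ofReal (hsum.const_mul _)
      (Eventually.of_forall fun v => mul_nonneg (inv_nonneg.2 (by positivity))
        (Finset.sum_nonneg fun i _ => by positivity)), integral_const_mul, hval]
    congr 1
    field_simp
  have hlint : ∫⁻ z, ENNReal.ofReal (F z) ∂(localGibbsLaw σ a₀ u₀ θ₀ N Φ) = ENNReal.ofReal m4 := by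
    rw [localGibbsLaw_eq, lintegral_localGibbsMeasure ha hθ hu (fun x => (ha0 x).le) hθ0 σ N hFm.ennreal_ofReal]
    simp_rw [hvel]
    have hρm : Measurable fun x : Fin (N + 1) → T3 => ENNReal.ofReal
        ((canonicalPartition (Torus.geometry (Fin 3)) (hsDiameter σ N) (N + 1)
          (localGibbsProfile a₀ u₀ θ₀))⁻¹ * posWeight a₀ (hsDiameter σ N) (N + 1) x) :=
      (measurable_const.mul (measurable_posWeight ha _ _)).ennreal_ofReal
    rw [lintegral_mul_const _ hρm, lintegral_posWeight_eq_one ha hθ hu (fun x => (ha0 x).le) hθ0 σ N,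
      one_mul]
  have hInt : Integrable F (localGibbsLaw σ a₀ u₀ θ₀ N Φ) := by
    refine ⟨hFm.aestronglyMeasurable, ?_⟩
    rw [hasFiniteIntegral_iff_ofReal (Eventually.of_forall hF0), hlint]
    exact ENNReal.ofReal_lt_top
  refine ⟨hInt, ?_⟩
  rw [integral_eq_lintegral_of_nonneg_ae (Eventually.of_forall hF0) hFm.aestronglyMeasurable, hlint,
    ENNReal.toReal_ofReal hm4_0]

/-- Measurability of the per-particle kinetic energy `⟨emp z, |v|²/2⟩`. [folklore] -/
theorem measurable_energy_one (N : ℕ) :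
    Measurable fun z : Config (N + 1) (Fin 3) T3 => empiricalEnergyField z fun _ => (1 : ℝ) := by
  simp_rw [empiricalEnergyField_eq_sum]
  refine measurable_const.mul (Finset.measurable_sum _ fun i _ => ?_)
  exact measurable_const.mul (((measurable_pi_apply i).snd.norm.pow_const 2).div_const 2)

/-- Elementary: `(a + b)² ≤ 2a² + 2b²` chained with `0 ≤ e ≤ Θ S + U²`, `S² ≤ F` gives
`e² ≤ 2Θ²F + 2U⁴`. [folklore] -/
theorem sq_le_of_le_affine {e S F Θ U : ℝ} (he0 : 0 ≤ e)
    (hA : e ≤ Θ * S + U ^ 2) (hJ : S ^ 2 ≤ F) : e ^ 2 ≤ 2 * Θ ^ 2 * F + 2 * U ^ 4 := by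
  have h1 : e ^ 2 ≤ (Θ * S + U ^ 2) ^ 2 := pow_le_pow_left₀ he0 hA 2
  have h2 : (Θ * S + U ^ 2) ^ 2 ≤ 2 * (Θ ^ 2 * S ^ 2) + 2 * U ^ 4 := by
    nlinarith [sq_nonneg (Θ * S - U ^ 2)]
  have h3 : Θ ^ 2 * S ^ 2 ≤ Θ ^ 2 * F := mul_le_mul_of_nonneg_left hJ (sq_nonneg Θ)
  linarith

/-- **Pointwise domination of the squared kinetic energy** by the quartic velocity fluctuation:
with `θ₀ ≤ Θ`, `‖u₀‖ ≤ U`, `θ₀ > 0`,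
`e(z)² ≤ 2Θ² (N+1)⁻¹ Σᵢ ‖vᵢ − u₀(xᵢ)‖⁴/θ₀(xᵢ)² + 2U⁴`. [folklore] -/
theorem sq_energy_le {θ₀ : T3 → ℝ} {u₀ : T3 → V3} {Θ U : ℝ} (hθ0 : ∀ x, 0 < θ₀ x)
    (hΘ : ∀ x, θ₀ x ≤ Θ) (hU : ∀ x, ‖u₀ x‖ ≤ U) (z : Config (N + 1) (Fin 3) T3) :
    (empiricalEnergyField z fun _ => (1 : ℝ)) ^ 2 ≤
      2 * Θ ^ 2 * (((N : ℝ) + 1)⁻¹ * ∑ i, ‖(z i).2 - u₀ (z i).1‖ ^ 4 / θ₀ (z i).1 ^ 2) + 2 * U ^ 4 := by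
  have hN : (0 : ℝ) < (N : ℝ) + 1 := by positivity
  set a : Fin (N + 1) → ℝ := fun i => ‖(z i).2 - u₀ (z i).1‖ ^ 2 / θ₀ (z i).1 with ha'
  have ha0' : ∀ i, 0 ≤ a i := fun i => div_nonneg (sq_nonneg _) (hθ0 _).le
  -- `|vᵢ|²/2 ≤ Θ aᵢ + U²`
  have hterm : ∀ i : Fin (N + 1), ‖(z i).2‖ ^ 2 / 2 ≤ Θ * a i + U ^ 2 := by
    intro i
    have hθi := hθ0 (z i).1
    have h1 : ‖(z i).2‖ ≤ ‖(z i).2 - u₀ (z i).1‖ + ‖u₀ (z i).1‖ := norm_le_norm_sub_add _ _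
    have h2 : ‖(z i).2‖ ^ 2 ≤ 2 * ‖(z i).2 - u₀ (z i).1‖ ^ 2 + 2 * ‖u₀ (z i).1‖ ^ 2 := by
      nlinarith [h1, sq_nonneg (‖(z i).2 - u₀ (z i).1‖ - ‖u₀ (z i).1‖), norm_nonneg ((z i).2),
        norm_nonneg ((z i).2 - u₀ (z i).1), norm_nonneg (u₀ (z i).1)]
    have h3 : ‖(z i).2 - u₀ (z i).1‖ ^ 2 = θ₀ (z i).1 * a i := by
      simp only [ha']; field_simp
    have h4 : ‖u₀ (z i).1‖ ^ 2 ≤ U ^ 2 := pow_le_pow_left₀ (norm_nonneg _) (hU _) 2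
    have h5 : θ₀ (z i).1 * a i ≤ Θ * a i := mul_le_mul_of_nonneg_right (hΘ _) (ha0' i)
    linarith
  have he : (empiricalEnergyField z fun _ => (1 : ℝ)) = ((N : ℝ) + 1)⁻¹ * ∑ i, ‖(z i).2‖ ^ 2 / 2 := by
    rw [empiricalEnergyField_eq_sum]; push_cast; simp
  set S : ℝ := ((N : ℝ) + 1)⁻¹ * ∑ i, a i with hS
  have hA : (empiricalEnergyField z fun _ => (1 : ℝ)) ≤ Θ * S + U ^ 2 := by
    rw [he, hS]
    calc ((N : ℝ) + 1)⁻¹ * ∑ i, ‖(z i).2‖ ^ 2 / 2 ≤ ((N : ℝ) + 1)⁻¹ * ∑ i, (Θ * a i + U ^ 2) :=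
          mul_le_mul_of_nonneg_left (Finset.sum_le_sum fun i _ => hterm i) (inv_nonneg.2 hN.le)
      _ = Θ * (((N : ℝ) + 1)⁻¹ * ∑ i, a i) + U ^ 2 := by
          rw [Finset.sum_add_distrib, Finset.sum_const, Finset.card_univ, Fintype.card_fin, nsmul_eq_mul,
            ← Finset.mul_sum]
          have hN' : ((N + 1 : ℕ) : ℝ) = (N : ℝ) + 1 := by push_cast; ring
          have hc : ((N : ℝ) + 1)⁻¹ * (((N : ℝ) + 1) * U ^ 2) = U ^ 2 := by
            rw [← mul_assoc, inv_mul_cancel₀ hN.ne', one_mul]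
          rw [hN', mul_add, hc]
          ring
  have he0 : 0 ≤ empiricalEnergyField z fun _ => (1 : ℝ) := by
    rw [he]; exact mul_nonneg (inv_nonneg.2 hN.le) (Finset.sum_nonneg fun i _ => by positivity)
  -- `(avg a)² ≤ avg (a²)`
  have hJ : S ^ 2 ≤ ((N : ℝ) + 1)⁻¹ * ∑ i, ‖(z i).2 - u₀ (z i).1‖ ^ 4 / θ₀ (z i).1 ^ 2 := by
    have hcs : (∑ i, a i) ^ 2 ≤ (Finset.univ : Finset (Fin (N + 1))).card * ∑ i, a i ^ 2 :=
      sq_sum_le_card_mul_sum_sq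
    rw [Finset.card_univ, Fintype.card_fin] at hcs
    have hN' : ((N + 1 : ℕ) : ℝ) = (N : ℝ) + 1 := by push_cast; ring
    rw [hN'] at hcs
    have hsq : ∀ i, a i ^ 2 = ‖(z i).2 - u₀ (z i).1‖ ^ 4 / θ₀ (z i).1 ^ 2 := by
      intro i
      simp only [ha']
      rw [div_pow, ← pow_mul]
    simp_rw [← hsq]
    rw [hS, mul_pow]
    calc ((N : ℝ) + 1)⁻¹ ^ 2 * (∑ i, a i) ^ 2 ≤ ((N : ℝ) + 1)⁻¹ ^ 2 * (((N : ℝ) + 1) * ∑ i, a i ^ 2) :=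
          mul_le_mul_of_nonneg_left hcs (by positivity)
      _ = ((N : ℝ) + 1)⁻¹ * ∑ i, a i ^ 2 := by
          rw [sq, mul_assoc, ← mul_assoc (((N : ℝ) + 1)⁻¹) ((N : ℝ) + 1), inv_mul_cancel₀ hN.ne', one_mul]
  exact sq_le_of_le_affine he0 hA hJ

/-- **Uniform second moment of the per-particle kinetic energy** under the local Gibbs laws
(continuous positive profiles, `σ ≤ 1/2`): `E_P[e²] ≤ 2Θ² E‖w‖⁴ + 2U⁴` for all `N` and all flows,
`Θ = sup θ₀`, `U = sup ‖u₀‖`. [folklore] -/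
theorem sq_energy_moment {σ : ℝ} (hσ2 : σ ≤ 1 / 2) {a₀ θ₀ : T3 → ℝ} {u₀ : T3 → V3}
    (ha : Continuous a₀) (hθ : Continuous θ₀) (hu : Continuous u₀) (ha0 : ∀ x, 0 < a₀ x)
    (hθ0 : ∀ x, 0 < θ₀ x) :
    ∃ M : ℝ, ∀ (N : ℕ) (Φ : Flow σ N),
      Integrable (fun z => (empiricalEnergyField z fun _ => (1 : ℝ)) ^ 2) (localGibbsLaw σ a₀ u₀ θ₀ N Φ) ∧
      ∫ z, (empiricalEnergyField z fun _ => (1 : ℝ)) ^ 2 ∂(localGibbsLaw σ a₀ u₀ θ₀ N Φ) ≤ M := by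
  obtain ⟨Θ, -, hΘ⟩ := exists_forall_abs_le_of_continuous hθ
  obtain ⟨U, -, hU⟩ := exists_forall_abs_le_of_continuous hu.norm
  have hΘ' : ∀ x, θ₀ x ≤ Θ := fun x => (le_abs_self _).trans (hΘ x)
  have hU' : ∀ x, ‖u₀ x‖ ≤ U := fun x => by simpa using hU x
  set m4 : ℝ := ∫ w, ‖w‖ ^ 4 ∂stdGaussian V3 with hm4
  refine ⟨2 * Θ ^ 2 * m4 + 2 * U ^ 4, fun N Φ => ?_⟩
  haveI := isProbabilityMeasure_localGibbsLaw ha hθ hu ha0 hθ0 hσ2 N Φ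
  set P : Measure (Config (N + 1) (Fin 3) T3) := localGibbsLaw σ a₀ u₀ θ₀ N Φ with hP
  set F4 : Config (N + 1) (Fin 3) T3 → ℝ := fun z =>
    ((N : ℝ) + 1)⁻¹ * ∑ i, ‖(z i).2 - u₀ (z i).1‖ ^ 4 / θ₀ (z i).1 ^ 2 with hF4
  set E2 : Config (N + 1) (Fin 3) T3 → ℝ := fun z => (empiricalEnergyField z fun _ => (1 : ℝ)) ^ 2 with hE2
  set g : Config (N + 1) (Fin 3) T3 → ℝ := fun z => 2 * Θ ^ 2 * F4 z + 2 * U ^ 4 with hg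
  obtain ⟨hI4, hval4⟩ := integral_velFluct4_localGibbsLaw hσ2 ha hθ hu ha0 hθ0 N Φ
  have hdom : ∀ z, E2 z ≤ g z := fun z => sq_energy_le (N := N) hθ0 hΘ' hU' z
  have hm : Measurable E2 := (measurable_energy_one N).pow_const 2
  have hgi : Integrable g P := (hI4.const_mul (2 * Θ ^ 2)).add (integrable_const (2 * U ^ 4))
  have hInt : Integrable E2 P := by
    refine hgi.mono' hm.aestronglyMeasurable (ae_of_all _ fun z => ?_)
    rw [Real.norm_eq_abs, abs_of_nonneg (sq_nonneg _)]
    exact hdom z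
  refine ⟨hInt, ?_⟩
  have hgval : ∫ z, g z ∂P = 2 * Θ ^ 2 * m4 + 2 * U ^ 4 := by
    simp only [hg]
    rw [integral_add (hI4.const_mul _) (integrable_const _), integral_const_mul, hval4, integral_const,
      smul_eq_mul, probReal_univ, one_mul]
  exact (integral_mono hInt hgi hdom).trans_eq hgval

/-! ## Almost surely distinct velocities -/

/-- The coincidence set `{vᵢ = vⱼ}` (`i ≠ j`) is Lebesgue-null in phase space. [folklore] -/
theorem volume_setOf_vel_eq {n : ℕ} {i j : Fin (n + 1)} (hij : i ≠ j) :
    volume {w : Config (n + 1) (Fin 3) T3 | (w i).2 = (w j).2} = 0 := by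
  obtain ⟨k, hk⟩ := Fin.exists_succAbove_eq hij.symm
  haveI hXE : SigmaFinite (volume : Measure (T3 × V3)) := inferInstance
  set e := MeasurableEquiv.piFinSuccAbove (fun _ : Fin (n + 1) => T3 × V3) i with he
  have hmp : MeasurePreserving e (volume : Measure (Config (n + 1) (Fin 3) T3))
      ((volume : Measure (T3 × V3)).prod (Measure.pi fun _ : Fin n => (volume : Measure (T3 × V3)))) :=
    measurePreserving_piFinSuccAbove (fun _ : Fin (n + 1) => (volume : Measure (T3 × V3))) i
  have hset : {w : Config (n + 1) (Fin 3) T3 | (w i).2 = (w j).2} =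
      e ⁻¹' {p : (T3 × V3) × (Fin n → T3 × V3) | p.1.2 = (p.2 k).2} := by
    ext w
    simp only [mem_setOf_eq, mem_preimage, he, MeasurableEquiv.piFinSuccAbove_apply,
      Fin.insertNthEquiv_symm_apply, Fin.removeNth, hk]
  have hSm : MeasurableSet {p : (T3 × V3) × (Fin n → T3 × V3) | p.1.2 = (p.2 k).2} :=
    measurableSet_eq_fun measurable_fst.snd ((measurable_pi_apply k).comp measurable_snd).snd
  rw [hset, hmp.measure_preimage hSm.nullMeasurableSet, Measure.prod_apply_symm hSm]
  have hsec : ∀ y : Fin n → T3 × V3,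
      (volume : Measure (T3 × V3)) ((fun x : T3 × V3 => (x, y)) ⁻¹'
        {p : (T3 × V3) × (Fin n → T3 × V3) | p.1.2 = (p.2 k).2}) = 0 := by
    intro y
    have : (fun x : T3 × V3 => (x, y)) ⁻¹' {p : (T3 × V3) × (Fin n → T3 × V3) | p.1.2 = (p.2 k).2} =
        (univ : Set T3) ×ˢ ({(y k).2} : Set V3) := by
      ext x
      simp
    rw [this, show (volume : Measure (T3 × V3)) = (volume : Measure T3).prod (volume : Measure V3) from rfl,
      Measure.prod_prod, measure_singleton, mul_zero]
  simp_rw [hsec]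
  rw [lintegral_zero]

/-- The coincidence set as a finite union, and its measurability. [folklore] -/
theorem measurableSet_coincidence (n : ℕ) :
    MeasurableSet (⋃ i : Fin (n + 1), ⋃ j : Fin (n + 1),
      {w : Config (n + 1) (Fin 3) T3 | i ≠ j ∧ (w i).2 = (w j).2}) := by
  refine MeasurableSet.iUnion fun i => MeasurableSet.iUnion fun j => ?_
  rw [setOf_and]
  exact (MeasurableSet.const _).inter
    (measurableSet_eq_fun (measurable_pi_apply i).snd (measurable_pi_apply j).snd)

/-- **Almost surely distinct velocities at every time.** Under a local Gibbs law transported by any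
flow map `Φ_s`, almost every configuration has pairwise distinct velocities. [folklore] -/
theorem ae_pairwise_vel_ne {σ : ℝ} (a₀ : T3 → ℝ) (u₀ : T3 → V3) (θ₀ : T3 → ℝ) (Φ : Flow σ N) (s : ℝ) :
    ∀ᵐ z ∂(localGibbsLaw σ a₀ u₀ θ₀ N Φ), ∀ i j : Fin (N + 1), i ≠ j →
      ((Φ.flow s z) i).2 ≠ ((Φ.flow s z) j).2 := by
  set S := ⋃ i : Fin (N + 1), ⋃ j : Fin (N + 1),
    {w : Config (N + 1) (Fin 3) T3 | i ≠ j ∧ (w i).2 = (w j).2} with hS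
  have hSm : MeasurableSet S := measurableSet_coincidence N
  have hvol : volume S = 0 := by
    refine (measure_iUnion_null_iff).2 fun i => (measure_iUnion_null_iff).2 fun j => ?_
    by_cases hij : i = j
    · have : {w : Config (N + 1) (Fin 3) T3 | i ≠ j ∧ (w i).2 = (w j).2} = ∅ := by
        ext w; simp [hij]
      rw [this, measure_empty]
    · have : {w : Config (N + 1) (Fin 3) T3 | i ≠ j ∧ (w i).2 = (w j).2} = {w | (w i).2 = (w j).2} := by
        ext w; simp [hij]
      rw [this]
      exact volume_setOf_vel_eq hij
  have hL : liouville (Torus.geometry (Fin 3)) (N + 1) (hsDiameter σ N) S = 0 := by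
    rw [liouville_eq]
    exact le_antisymm ((Measure.restrict_le_self S).trans_eq hvol) bot_le
  have hP : localGibbsLaw σ a₀ u₀ θ₀ N Φ ≪ liouville (Torus.geometry (Fin 3)) (N + 1) (hsDiameter σ N) := by
    rw [localGibbsLaw, particleLaw_eq]; exact withDensity_absolutelyContinuous _ _
  have hmap : (localGibbsLaw σ a₀ u₀ θ₀ N Φ).map (Φ.flow s) ≪
      liouville (Torus.geometry (Fin 3)) (N + 1) (hsDiameter σ N) := by
    have h := hP.map (Φ.measurable_flow s)
    rwa [(Φ.measurePreserving s).map_eq] at h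
  have hpre : localGibbsLaw σ a₀ u₀ θ₀ N Φ (Φ.flow s ⁻¹' S) = 0 := by
    rw [← Measure.map_apply (Φ.measurable_flow s) hSm]
    exact hmap hL
  rw [ae_iff]
  refine measure_mono_null (fun z hz => ?_) hpre
  simp only [mem_setOf_eq, not_forall, not_not, exists_prop] at hz
  obtain ⟨i, j, hij, h⟩ := hz
  exact mem_iUnion.2 ⟨i, mem_iUnion.2 ⟨j, hij, h⟩⟩

end Clausius

/-- Registered sub-goal `stub_clausius_moment` of the stub `stub_clausius`: uniform second moment of
the per-particle kinetic energy `⟨emp, |v|²/2⟩` under the local Gibbs laws of continuous positive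
profiles, `σ ≤ 1/2`, for all `N` and all flows (`Clausius.sq_energy_moment`). [folklore] -/
theorem stub_clausius_moment : ∀ (a₀ θ₀ : T3 → ℝ) (u₀ : T3 → V3), Continuous a₀ → Continuous θ₀ → Continuous u₀ → (∀ x, 0 < a₀ x) → (∀ x, 0 < θ₀ x) → ∀ σ : ℝ, σ ≤ 1 / 2 → ∃ M : ℝ, ∀ (N : ℕ) (Φ : Flow σ N), Integrable (fun z => (empiricalEnergyField z fun _ => (1 : ℝ)) ^ 2) (localGibbsLaw σ a₀ u₀ θ₀ N Φ) ∧ ∫ z, (empiricalEnergyField z fun _ => (1 : ℝ)) ^ 2 ∂(localGibbsLaw σ a₀ u₀ θ₀ N Φ) ≤ M :=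
  fun _ _ _ ha hθ hu ha0 hθ0 _ hσ2 => Clausius.sq_energy_moment hσ2 ha hθ hu ha0 hθ0

end Barycentric

end Summit.AtomisticToContinuum.HydrodynamicLimit.Theorems.MacroClosureLine

end
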